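import Mathlib
import Literature.Topology.FourManifolds.LickorishWallaceProofs

/-! crux-triage r1 k=2 (refuter-cruxtri-stmt-FinalStateConjecture-14075-r1-2-0):
`HullDichotomy` of card kerr-isolation-dichotomy (SketchIdeator1.lean, copied verbatim as `HullDichotomy'`)
is PROVED: ω-limit sets of points under continuous real flows on compact Hausdorff spaces are (pre)connected
(nested-continua lemma `Literature.Topology.FourManifolds.isPreconnected_iInter_of_antitone`), and a preconnected
set inside `S` cannot straddle a subset `K` that is closed and relatively open in `S`. -/

open Set Filter Topology

/-- verbatim copy of `Summit.FinalStateConjecture.FinalStateConjecture.Cruxes.ChannelsResolveTameDevelopmentsR.HullDichotomy` -/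
def HullDichotomy' : Prop :=
  ∀ (H : Type) [TopologicalSpace H] [CompactSpace H] [T2Space H] (ϕ : Flow ℝ H)
    (S K : Set H) (x : H),
    IsClosed S → IsClosed K → K ⊆ S → (∃ U : Set H, IsOpen U ∧ U ∩ S = K) →
    omegaLimit atTop (fun t y ↦ ϕ t y) {x} ⊆ S →
    omegaLimit atTop (fun t y ↦ ϕ t y) {x} ⊆ K ∨
      Disjoint (omegaLimit atTop (fun t y ↦ ϕ t y) {x}) K

theorem subset_or_disjoint_of_isPreconnected' {H : Type} [TopologicalSpace H]
    {Ω S K U : Set H} (hΩ : IsPreconnected Ω) (hK : IsClosed K) (hU : IsOpen U)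
    (hUK : U ∩ S = K) (hΩS : Ω ⊆ S) : Ω ⊆ K ∨ Disjoint Ω K := by
  classical
  by_cases h : (Ω ∩ K).Nonempty
  · left
    have hKU : K ⊆ U := fun y hy ↦ (hUK.symm ▸ hy : y ∈ U ∩ S).1
    have hcover : Ω ⊆ U ∪ Kᶜ := fun y _ ↦ by
      by_cases hy : y ∈ K
      · exact Or.inl (hKU hy)
      · exact Or.inr hy
    have hmeetU : (Ω ∩ U).Nonempty := by
      obtain ⟨y, hyΩ, hyK⟩ := h
      exact ⟨y, hyΩ, hKU hyK⟩
    intro y hyΩ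
    by_contra hyK
    have hmeetC : (Ω ∩ Kᶜ).Nonempty := ⟨y, hyΩ, hyK⟩
    obtain ⟨z, hzΩ, hzU, hzC⟩ := hΩ U Kᶜ hU hK.isOpen_compl hcover hmeetU hmeetC
    exact hzC (hUK ▸ ⟨hzU, hΩS hzΩ⟩ : z ∈ K)
  · right
    exact Set.disjoint_iff_inter_eq_empty.mpr (Set.not_nonempty_iff_eq_empty.mp h)

/-- ω-limit of a point under a continuous real flow, as a nested intersection over `ℕ`. -/
theorem omegaLimit_point_eq_iInter_nat {H : Type} [TopologicalSpace H] (ϕ : Flow ℝ H) (x : H) :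
    omegaLimit atTop (fun t y ↦ ϕ t y) {x} = ⋂ n : ℕ, closure ((fun t : ℝ ↦ ϕ t x) '' Ici (n : ℝ)) := by
  ext y
  simp only [omegaLimit_def, mem_iInter, image2_singleton_right]
  constructor
  · intro h n
    exact h (Ici (n : ℝ)) (Ici_mem_atTop _)
  · intro h u hu
    obtain ⟨a, ha⟩ := mem_atTop_sets.1 hu
    have hsub : Ici (⌈a⌉₊ : ℝ) ⊆ u := fun t ht ↦ ha t (le_trans (Nat.le_ceil a) ht)
    exact closure_mono (image_mono hsub) (h ⌈a⌉₊)

theorem isPreconnected_omegaLimit_point {H : Type} [TopologicalSpace H] [CompactSpace H] [T2Space H]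
    (ϕ : Flow ℝ H) (x : H) : IsPreconnected (omegaLimit atTop (fun t y ↦ ϕ t y) {x}) := by
  rw [omegaLimit_point_eq_iInter_nat]
  refine Literature.Topology.FourManifolds.isPreconnected_iInter_of_antitone ?_ ?_ ?_
  · intro m n hmn
    exact closure_mono (image_mono (Ici_subset_Ici.2 (by exact_mod_cast hmn)))
  · intro n
    exact isClosed_closure.isCompact
  · intro n
    refine (IsPreconnected.image isPreconnected_Ici _ ?_).closure
    exact (ϕ.continuous continuous_id continuous_const).continuousOn

theorem hullDichotomy'_holds : HullDichotomy' := by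
  intro H _ _ _ ϕ S K x hS hK hKS hU hΩS
  obtain ⟨U, hUo, hUK⟩ := hU
  exact subset_or_disjoint_of_isPreconnected' (isPreconnected_omegaLimit_point ϕ x) hK hUo hUK hΩS
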